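import Literature.InformationTheory.QuantumCodes.DistanceFailureFloorStabilizer
import Literature.InformationTheory.QuantumCodes.StabilizerErasureCapacity
import Summits.Ventures.QEC.Decoders.GottesmanFamiliesOptimalRadius
import HarnessLib

/-!
# Distance FLOORS for non-CSS stabilizer codes with KERNEL distance certificates: the five-qubit code `[[5,1,3]]`
# and Gottesman's `[[2^m, 2^m − m − 2, 3]]` family (no threshold under any decoder)

Venture QEC, `Summits/Ventures/QEC/Thresholds/` (LADDER-QEC rungs Q4/Q5; qec-lit-2 gen 7). HONEST FRAMING. The tree's
general floors — `Literature/…/DistanceFailureFloorStabilizer.lean` (every decoder of every stabilizer code with a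
logical operator, depolarizing `0 ≤ p ≤ 3/4`: `½·C(d,⌈d/2⌉)(p/3)^{⌈d/2⌉}(1−p)^{⌊d/2⌋} ≤ P_fail`, `d = minDistance S̄`;
"`L/2` errors could suffice", Dennis et al. §3) and `Literature/…/StabilizerErasureCapacity.lean` (erasure: `y^d ≤
P_y[non-correctable]`; bounded `d` ⇒ accuracy threshold `0`) — are fed with the KERNEL symplectic distance certificates of
`Summits/Ventures/QEC/Decoders/GottesmanFamiliesOptimalRadius.lean` (`fiveQubitCode_minDistance : minDistance = 3`,
`gottesmanCode_minDistance : minDistance (G_m) = 3` for every `m ≥ 3`). Every row is an UNCONDITIONAL kernel theorem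
about the named NON-CSS code, valid for every decoder (any syndrome map blind to `S̄⊥`, the genuine generator syndrome
included):

| code | depolarizing floor (`0 ≤ p ≤ 3/4`) | erasure floor (`0 ≤ y ≤ 1`) |
|---|---|---|
| `[[5,1,3]]` (Laflamme et al. / Bennett et al.; Gottesman §3.4) | `p²(1−p)/6 ≤ P_fail` | `y³ ≤ P_y` |
| `[[2^m, 2^m−m−2, 3]]`, every `m ≥ 3` (Gottesman 1996; CRSS Thm 10) | `p²(1−p)/6 ≤ P_fail` | `y³ ≤ P_y` |

and for the FAMILY `m = 3, 4, 5, …` (rate `→ 1`, distance `3` for all `m`): NO depolarizing rate `0 < p ≤ 3/4` and NO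
erasure rate `0 < y ≤ 1` is below threshold for ANY decoder family; both accuracy thresholds are `0`
(`gottesmanFamily_depolarizing_accuracyThreshold_eq_zero`, `gottesmanFamily_erasure_accuracyThreshold_eq_zero`). This is
the content of "bounded distance ⇒ no threshold" for a named non-CSS family, nothing more: no Monte Carlo value, no
statement about finite-`m` performance beyond the displayed floors, floors and ceilings never merged.

## References

* [Gottesman1997] D. Gottesman, PhD thesis, arXiv:quant-ph/9705052, §3.3–§3.4 (the five-qubit code), §8.3
  (the `[[2^j, 2^j − j − 2, 3]]` codes).
* [CalderbankEtAl1998] Calderbank–Rains–Shor–Sloane, IEEE TIT 44 (1998) 1369, §5 Thm. 10.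
* [DennisEtAl2002] Dennis–Kitaev–Landahl–Preskill, J. Math. Phys. 43 (2002) 4452, §3 ("L/2 errors"), §4.3, §4.6.
* [DelfosseZemor2013] Delfosse–Zémor, QIC 13 (2013) 793, §3.1 (non-correctable erasure).
-/

namespace Summit.Ventures.QEC.Thresholds

open Finset Matrix Filter Topology
open Literature.InformationTheory.QuantumCodes Literature.Computability.QuantumComplexity
open Summit.Ventures.QEC.Decoders.GottesmanFamilies

/-! ## The five-qubit code `[[5,1,3]]` -/

/-- The five-qubit code has a logical operator (`minDistance = 3 > 0`). (proved)
[cite: Gottesman1997, §3.4 (the five-qubit code)] -/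
theorem fiveQubitCode_minDistance_pos : 0 < minDistance fiveQubitCode := by
  rw [fiveQubitCode_minDistance]
  norm_num

/-- The distance-floor constant at `d = 3`: `½·C(3,2)·(p/3)²·(1−p) = p²(1−p)/6`. [folklore] -/
theorem distanceFloor_three (p : ℝ) :
    (1 : ℝ) / 2 * (((3 : ℕ).choose ((3 + 1) / 2) : ℝ) * ((p / 3) ^ ((3 + 1) / 2) * (1 - p) ^ (3 / 2))) =
      p ^ 2 * (1 - p) / 6 := by
  norm_num [Nat.choose]
  ring

open Classical in
/-- **Depolarizing floor of the five-qubit code, EVERY decoder**: for every syndrome map blind to `S̄⊥` and every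
decoder, at depolarizing rate `0 ≤ p ≤ 3/4`: `p²(1−p)/6 ≤ P_fail` (two of the three qubits of a weight-3 logical hit in
matching letters cannot be told from the complementary single error). (proved)
[cite: DennisEtAl2002, §3 (L/2 errors could suffice) and §4.3; Gottesman1997, §3.4] -/
theorem fiveQubitCode_depolarizingFloor {Syn : Type*} (D : Decoder Syn (SympVec 5)) (syn : SympVec 5 → Syn)
    (hsyn : ∀ v, ∀ L ∈ sympDual fiveQubitCode, syn (v + L) = syn v) {p : ℝ} (hp0 : 0 ≤ p) (hp : p ≤ 3 / 4) :
    p ^ 2 * (1 - p) / 6 ≤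
      ∑ v ∈ univ.filter (fun v : SympVec 5 => ¬ D.Corrects syn (fiveQubitCode : Set (SympVec 5)) v),
        depolarizingProb p (toPauliString v) := by
  have h := distanceFloor_le_depolarizingFailure fiveQubitCode fiveQubitCode_minDistance_pos D syn hsyn hp0 hp
  rw [fiveQubitCode_minDistance, distanceFloor_three] at h
  exact h

open Classical in
/-- **Generator-syndrome form**: every decoder of the genuine syndrome of the four generators `XZZXI, IXZZX, XIXZZ,
ZXIXZ` obeys `p²(1−p)/6 ≤ P_fail` at depolarizing rate `0 ≤ p ≤ 3/4`. (proved)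
[cite: Gottesman1997, §3.4 (generators of the five-qubit code); DennisEtAl2002, §3 and §4.3] -/
theorem fiveQubitCode_depolarizingFloor_sympSyndrome (D : Decoder (Fin 4 → ZMod 2) (SympVec 5)) {p : ℝ}
    (hp0 : 0 ≤ p) (hp : p ≤ 3 / 4) :
    p ^ 2 * (1 - p) / 6 ≤
      ∑ v ∈ univ.filter (fun v : SympVec 5 =>
          ¬ D.Corrects (sympSyndrome fiveQubitRows) (fiveQubitCode : Set (SympVec 5)) v),
        depolarizingProb p (toPauliString v) :=
  fiveQubitCode_depolarizingFloor D (sympSyndrome fiveQubitRows)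
    (fun v _ hL => sympSyndrome_add_of_mem_sympDual fiveQubitRows hL v) hp0 hp

open Classical in
/-- **Erasure floor of the five-qubit code**: `y³ ≤ P_y[erasure non-correctable]` for every erasure rate `0 ≤ y ≤ 1`
(the erasures containing the support of a weight-3 logical operator). (proved)
[cite: DelfosseZemor2013, §3.1 (non-correctable erasure); Gottesman1997, §3.4] -/
theorem fiveQubitCode_erasureFloor {y : ℝ} (hy0 : 0 ≤ y) (hy1 : y ≤ 1) :
    y ^ 3 ≤ eventProb (fun M : Finset (Fin 5) => ¬ IsCorrectableRegion fiveQubitCode M) y := by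
  have h := pow_minDistance_le_erasureFailure fiveQubitCode_minDistance_pos hy0 hy1
  rw [fiveQubitCode_minDistance] at h
  exact h

/-! ## Gottesman's `[[2^m, 2^m − m − 2, 3]]` family: floors for every `m ≥ 3`, no threshold for the family -/

section Gottesman

variable (G : ∀ i : ℕ, Matrix (Fin (i + 3)) (Fin (i + 3)) (ZMod 2))

/-- The `i`-th member of the family is Gottesman's code `G_{i+3}` on `2^{i+3}` qubits; its distance is exactly `3`
(`G` injective and fixed-point-free). (proved) [cite: CalderbankEtAl1998, §5 Thm. 10; Gottesman1997, §8.3] -/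
theorem gottesmanFamily_minDistance (hG : ∀ i c, G i *ᵥ c = 0 → c = 0) (hfix : ∀ i c, G i *ᵥ c = c → c = 0)
    (i : ℕ) : minDistance (gottesmanCode (G i)) = 3 :=
  gottesmanCode_minDistance (by omega) (G i) (hG i) (hfix i)

/-- Every member of the family has a logical operator. (proved) [cite: CalderbankEtAl1998, §5 Thm. 10] -/
theorem gottesmanFamily_minDistance_pos (hG : ∀ i c, G i *ᵥ c = 0 → c = 0) (hfix : ∀ i c, G i *ᵥ c = c → c = 0)
    (i : ℕ) : 0 < minDistance (gottesmanCode (G i)) := by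
  rw [gottesmanFamily_minDistance G hG hfix i]
  norm_num

open Classical in
/-- **Depolarizing floor of every `[[2^m, 2^m − m − 2, 3]]` code, every decoder** (`m = i + 3 ≥ 3`, any syndrome map
blind to `S̄⊥`, `0 ≤ p ≤ 3/4`): `p²(1−p)/6 ≤ P_fail`. (proved)
[cite: DennisEtAl2002, §3 and §4.3; Gottesman1997, §8.3; CalderbankEtAl1998, §5 Thm. 10] -/
theorem gottesmanFamily_depolarizingFloor (hG : ∀ i c, G i *ᵥ c = 0 → c = 0)
    (hfix : ∀ i c, G i *ᵥ c = c → c = 0) (i : ℕ) {Syn : Type*} (D : Decoder Syn (SympVec (2 ^ (i + 3))))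
    (syn : SympVec (2 ^ (i + 3)) → Syn) (hsyn : ∀ v, ∀ L ∈ sympDual (gottesmanCode (G i)), syn (v + L) = syn v)
    {p : ℝ} (hp0 : 0 ≤ p) (hp : p ≤ 3 / 4) :
    p ^ 2 * (1 - p) / 6 ≤
      ∑ v ∈ univ.filter (fun v : SympVec (2 ^ (i + 3)) =>
          ¬ D.Corrects syn (gottesmanCode (G i) : Set (SympVec (2 ^ (i + 3)))) v),
        depolarizingProb p (toPauliString v) := by
  have h := distanceFloor_le_depolarizingFailure (gottesmanCode (G i)) (gottesmanFamily_minDistance_pos G hG hfix i)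
    D syn hsyn hp0 hp
  rw [gottesmanFamily_minDistance G hG hfix i, distanceFloor_three] at h
  exact h

open Classical in
/-- **Erasure floor of every `[[2^m, 2^m − m − 2, 3]]` code**: `y³ ≤ P_y[erasure non-correctable]` (`0 ≤ y ≤ 1`).
(proved) [cite: DelfosseZemor2013, §3.1; CalderbankEtAl1998, §5 Thm. 10] -/
theorem gottesmanFamily_erasureFloor (hG : ∀ i c, G i *ᵥ c = 0 → c = 0) (hfix : ∀ i c, G i *ᵥ c = c → c = 0)
    (i : ℕ) {y : ℝ} (hy0 : 0 ≤ y) (hy1 : y ≤ 1) :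
    y ^ 3 ≤ eventProb (fun M : Finset (Fin (2 ^ (i + 3))) => ¬ IsCorrectableRegion (gottesmanCode (G i)) M) y := by
  have h := pow_minDistance_le_erasureFailure (gottesmanFamily_minDistance_pos G hG hfix i) hy0 hy1
  rw [gottesmanFamily_minDistance G hG hfix i] at h
  exact h

open Classical in
/-- **NO DEPOLARIZING THRESHOLD for Gottesman's distance-3 family, ANY decoders**: for every choice of syndrome maps
blind to `S̄⊥` and decoders `D_i`, no depolarizing rate `0 < p ≤ 3/4` is below threshold (`P_fail ≥ ½(p/3)³`
uniformly in `i`). (proved) [cite: DennisEtAl2002, §4.3 (below threshold); Gottesman1997, §8.3] -/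
theorem gottesmanFamily_not_belowThreshold_depolarizing (hG : ∀ i c, G i *ᵥ c = 0 → c = 0)
    (hfix : ∀ i c, G i *ᵥ c = c → c = 0) {Syn : ℕ → Type*} (syn : ∀ i, SympVec (2 ^ (i + 3)) → Syn i)
    (D : ∀ i, Decoder (Syn i) (SympVec (2 ^ (i + 3))))
    (hsyn : ∀ i v, ∀ L ∈ sympDual (gottesmanCode (G i)), syn i (v + L) = syn i v) {p : ℝ} (hp0 : 0 < p)
    (hp : p ≤ 3 / 4) :
    ¬ BelowThreshold (fun i p => ∑ v ∈ univ.filter (fun v : SympVec (2 ^ (i + 3)) =>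
        ¬ (D i).Corrects (syn i) (gottesmanCode (G i) : Set (SympVec (2 ^ (i + 3)))) v),
          depolarizingProb p (toPauliString v)) p :=
  not_belowThreshold_depolarizing_of_minDistance_le (fun i => gottesmanCode (G i)) syn D
    (gottesmanFamily_minDistance_pos G hG hfix) hsyn (w := 3) (fun i => (gottesmanFamily_minDistance G hG hfix i).le)
    hp0 hp

open Classical in
/-- **Depolarizing accuracy threshold `0`** for every decoder family of Gottesman's `[[2^m, 2^m − m − 2, 3]]` codes.
(proved) [cite: DennisEtAl2002, §4.6 (p_c); Gottesman1997, §8.3] -/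
theorem gottesmanFamily_depolarizing_accuracyThreshold_eq_zero (hG : ∀ i c, G i *ᵥ c = 0 → c = 0)
    (hfix : ∀ i c, G i *ᵥ c = c → c = 0) {Syn : ℕ → Type*} (syn : ∀ i, SympVec (2 ^ (i + 3)) → Syn i)
    (D : ∀ i, Decoder (Syn i) (SympVec (2 ^ (i + 3))))
    (hsyn : ∀ i v, ∀ L ∈ sympDual (gottesmanCode (G i)), syn i (v + L) = syn i v) :
    accuracyThreshold (fun i p => ∑ v ∈ univ.filter (fun v : SympVec (2 ^ (i + 3)) =>
        ¬ (D i).Corrects (syn i) (gottesmanCode (G i) : Set (SympVec (2 ^ (i + 3)))) v),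
          depolarizingProb p (toPauliString v)) = 0 :=
  depolarizing_accuracyThreshold_eq_zero_of_minDistance_le (fun i => gottesmanCode (G i)) syn D
    (gottesmanFamily_minDistance_pos G hG hfix) hsyn (w := 3) (fun i => (gottesmanFamily_minDistance G hG hfix i).le)

open Classical in
/-- **NO ERASURE THRESHOLD for Gottesman's distance-3 family**: no erasure rate `0 < y ≤ 1` is below threshold
(`P_y ≥ y³` uniformly in `i`). (proved) [cite: DennisEtAl2002, §4.3; DelfosseZemor2013, §3.1] -/
theorem gottesmanFamily_not_belowThreshold_erasure (hG : ∀ i c, G i *ᵥ c = 0 → c = 0)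
    (hfix : ∀ i c, G i *ᵥ c = c → c = 0) {y : ℝ} (hy0 : 0 < y) (hy1 : y ≤ 1) :
    ¬ BelowThreshold (fun i y => eventProb
      (fun M : Finset (Fin (2 ^ (i + 3))) => ¬ IsCorrectableRegion (gottesmanCode (G i)) M) y) y :=
  stabilizer_erasure_not_belowThreshold_of_minDistance_le (fun i => gottesmanCode (G i))
    (gottesmanFamily_minDistance_pos G hG hfix) (w := 3) (fun i => (gottesmanFamily_minDistance G hG hfix i).le)
    hy0 hy1

open Classical in
/-- **Erasure accuracy threshold `0`** for Gottesman's `[[2^m, 2^m − m − 2, 3]]` family. (proved)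
[cite: DennisEtAl2002, §4.6 (p_c); DelfosseZemor2013, §3.1] -/
theorem gottesmanFamily_erasure_accuracyThreshold_eq_zero (hG : ∀ i c, G i *ᵥ c = 0 → c = 0)
    (hfix : ∀ i c, G i *ᵥ c = c → c = 0) :
    accuracyThreshold (fun i y => eventProb
      (fun M : Finset (Fin (2 ^ (i + 3))) => ¬ IsCorrectableRegion (gottesmanCode (G i)) M) y) = 0 :=
  stabilizer_erasure_accuracyThreshold_eq_zero_of_minDistance_le (fun i => gottesmanCode (G i))
    (gottesmanFamily_minDistance_pos G hG hfix) (w := 3) (fun i => (gottesmanFamily_minDistance G hG hfix i).le)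

end Gottesman

end Summit.Ventures.QEC.Thresholds
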